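import Mathlib.Topology.FiberBundle.Basic
import Mathlib.Topology.Compactness.Paracompact
import Mathlib.Topology.Maps.Proper.Basic
import Mathlib.Topology.LocalAtTarget
import HarnessLib

/-!
# Total spaces of fibre bundles with compact fibre over paracompact bases are paracompact

Topic `Literature/AlgebraicTopology/CharacteristicClasses`. D. Husemoller, *Fibre Bundles*, Ch. 17
(2.4): "if `B` is paracompact, then `E(Pξ)` is paracompact" — the total space of the projective
bundle of a vector bundle (fibre `ℂP^{n-1}`, compact) over a paracompact base is paracompact, the
point-set input of the splitting principle (Prop. 5.2, Thm. 5.4: the splitting map `q : E(Pξ) → B`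
must again have a paracompact source so that the axioms (C₁), (C₂) apply to `q*ξ`). We prove the
two classical general-topology facts behind it:

* `paracompactSpace_of_isProperMap` — **the source of a proper (= closed, compact fibres,
  continuous) map onto... into a paracompact space is paracompact** (Engelking, *General Topology*,
  Thm. 5.1.35; Michael): cover each fibre by finitely many members of a given open cover, push the
  finite unions down to open neighbourhoods in the base by closedness, refine those precisely and
  locally finitely in the base, and pull back;
* `isClosedMap_proj_of_compactSpace`, `isProperMap_proj_of_compactSpace` — **the projection of a
  (locally trivial) fibre bundle with compact fibre is closed, hence proper**: closedness is local
  on the target (`IsOpenCover.isClosedMap_iff_restrictPreimage`) and over a trivialising open set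
  the projection is `Prod.fst : U × F → U`, closed for compact `F`;
* `paracompactSpace_totalSpace` — hence **the total space of a fibre bundle with compact fibre
  over a paracompact base is paracompact** (Husemoller (2.4)).

Everything is proved; no named facts. Mathlib has paracompactness of closed subspaces
(`IsClosedEmbedding.paracompactSpace`) and of products with a compact factor, but not the
perfect-preimage theorem (searched `paracompactSpace_of`, `IsProperMap` + `Paracompact`: nothing).

## References

* [HusemollerFibreBundles1994] D. Husemoller, *Fibre Bundles*, 3rd ed., GTM 20 (1994), Ch. 17 (2.4).
* R. Engelking, *General Topology* (1989), Thm. 5.1.35 (perfect preimages of paracompact spaces).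
-/

open Set Filter Function Bundle Topology TopologicalSpace

universe u v w

namespace Literature.AlgebraicTopology.CharacteristicClasses

/-! ### Perfect preimages of paracompact spaces -/

/-- **The source of a proper map into a paracompact space is paracompact** (perfect preimages of
paracompact spaces are paracompact). Given an open cover `s` of `X`: each fibre `f ⁻¹' {y}` is
compact, so covered by `⋃ a ∈ T y, s a` for a finite `T y`; since `f` is closed,
`V y = (f '' (⋃ a ∈ T y, s a)ᶜ)ᶜ` is an open neighbourhood of `y` with `f ⁻¹' (V y)` inside that
finite union; a precise locally finite refinement `r y ⊆ V y` of the cover `V` of `Y` then yields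
the locally finite open refinement `s a ∩ f ⁻¹' (⋃ {r y | a ∈ T y})` of `s`, indexed by the same
type. [cite: HusemollerFibreBundles1994, Ch. 17 (2.4)] -/
theorem paracompactSpace_of_isProperMap {X : Type u} {Y : Type v} [TopologicalSpace X]
    [TopologicalSpace Y] [ParacompactSpace Y] {f : X → Y} (hf : IsProperMap f) :
    ParacompactSpace X := by
  refine ⟨fun α s hso hsc ↦ ?_⟩
  -- each fibre is covered by finitely many members of the cover
  have hfib : ∀ y : Y, ∃ T : Finset α, f ⁻¹' {y} ⊆ ⋃ a ∈ T, s a := fun y ↦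
    (hf.isCompact_preimage isCompact_singleton).elim_finite_subcover s hso
      (by rw [hsc]; exact subset_univ _)
  choose T hT using hfib
  -- open neighbourhoods `V y` of `y` whose preimages lie in these finite unions
  let W : Y → Set X := fun y ↦ ⋃ a ∈ T y, s a
  let V : Y → Set Y := fun y ↦ (f '' (W y)ᶜ)ᶜ
  have hWo : ∀ y, IsOpen (W y) := fun y ↦ isOpen_biUnion fun a _ ↦ hso a
  have hVo : ∀ y, IsOpen (V y) := fun y ↦
    (hf.isClosedMap _ (hWo y).isClosed_compl).isOpen_compl
  have hyV : ∀ y, y ∈ V y := by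
    rintro y ⟨x, hx, hxy⟩
    exact hx (hT y hxy)
  have hfV : ∀ y, f ⁻¹' V y ⊆ W y := fun y x hx ↦ by
    by_contra h
    exact hx ⟨x, h, rfl⟩
  obtain ⟨r, hro, hrc, hrf, hrV⟩ :=
    precise_refinement V hVo (univ_subset_iff.1 fun y _ ↦ mem_iUnion.2 ⟨y, hyV y⟩)
  refine ⟨α, fun a ↦ s a ∩ f ⁻¹' ⋃ y ∈ {y | a ∈ T y}, r y, fun a ↦
    (hso a).inter ((isOpen_biUnion fun y _ ↦ hro y).preimage hf.continuous), ?_, ?_,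
    fun a ↦ ⟨a, inter_subset_left⟩⟩
  · -- the refinement covers
    refine univ_subset_iff.1 fun x _ ↦ ?_
    have hx : f x ∈ ⋃ y, r y := by rw [hrc]; trivial
    obtain ⟨y, hy⟩ := mem_iUnion.1 hx
    obtain ⟨a, ha, hxa⟩ := mem_iUnion₂.1 (hfV y (hrV y hy))
    exact mem_iUnion.2 ⟨a, hxa, mem_iUnion₂.2 ⟨y, ha, hy⟩⟩
  · -- and is locally finite
    intro x
    obtain ⟨N, hN, hfin⟩ := hrf (f x)
    refine ⟨f ⁻¹' N, hf.continuous.continuousAt.preimage_mem_nhds hN, ?_⟩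
    refine (hfin.biUnion fun y _ ↦ (T y).finite_toSet).subset ?_
    rintro a ⟨z, ⟨-, hz⟩, hzN⟩
    obtain ⟨y, hy, hzy⟩ := mem_iUnion₂.1 hz
    exact mem_iUnion₂.2 ⟨y, ⟨f z, hzy, hzN⟩, hy⟩

/-! ### Fibre bundles with compact fibre -/

section FiberBundle

variable {B : Type u} (F : Type v) {E : B → Type w} [TopologicalSpace B] [TopologicalSpace F]
  [TopologicalSpace (TotalSpace F E)] [∀ b, TopologicalSpace (E b)] [FiberBundle F E]

/-- **The projection of a fibre bundle with compact fibre is a closed map**: closedness is local on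
the base, and over a trivialising open set `U` the projection is conjugate
(`Trivialization.preimageHomeomorph`) to `Prod.fst : U × F → U`, which is closed for compact `F`.
[cite: HusemollerFibreBundles1994, Ch. 17 (2.4)] -/
theorem isClosedMap_proj_of_compactSpace [CompactSpace F] : IsClosedMap (π F E) := by
  let U : B → Opens B := fun b ↦ ⟨(trivializationAt F E b).baseSet, (trivializationAt F E b).open_baseSet⟩
  have hU : IsOpenCover U := by
    refine IsOpenCover.mk (eq_top_iff.2 fun b _ ↦ ?_)
    exact Opens.mem_iSup.2 ⟨b, FiberBundle.mem_baseSet_trivializationAt F E b⟩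
  rw [hU.isClosedMap_iff_restrictPreimage]
  intro b
  let e := trivializationAt F E b
  let h : π F E ⁻¹' e.baseSet ≃ₜ ↥e.baseSet × F := e.preimageHomeomorph subset_rfl
  have hcomp : (U b).1.restrictPreimage (π F E) = Prod.fst ∘ h := by
    funext p
    simp [h, U, e, Set.restrictPreimage, MapsTo.restrict, Subtype.map]
  rw [hcomp]
  exact isClosedMap_fst_of_compactSpace.comp h.isClosedMap

/-- **The projection of a fibre bundle with compact fibre is a proper map** (closed with compact
fibres: each fibre is homeomorphic to `F`, `Trivialization.preimageSingletonHomeomorph`).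
[cite: HusemollerFibreBundles1994, Ch. 17 (2.4)] -/
theorem isProperMap_proj_of_compactSpace [CompactSpace F] : IsProperMap (π F E) := by
  rw [isProperMap_iff_isClosedMap_and_compact_fibers]
  refine ⟨FiberBundle.continuous_proj F E, isClosedMap_proj_of_compactSpace F, fun b ↦ ?_⟩
  have h : π F E ⁻¹' {b} ≃ₜ F := (trivializationAt F E b).preimageSingletonHomeomorph
    (FiberBundle.mem_baseSet_trivializationAt F E b)
  exact isCompact_iff_compactSpace.2 h.symm.compactSpace

/-- **The total space of a fibre bundle with compact fibre over a paracompact base is paracompact**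
(Husemoller Ch. 17 (2.4): "if `B` is paracompact, then `E(Pξ)` is paracompact").
[cite: HusemollerFibreBundles1994, Ch. 17 (2.4)] -/
theorem paracompactSpace_totalSpace [CompactSpace F] [ParacompactSpace B] :
    ParacompactSpace (TotalSpace F E) :=
  paracompactSpace_of_isProperMap (isProperMap_proj_of_compactSpace F (E := E))

end FiberBundle

end Literature.AlgebraicTopology.CharacteristicClasses
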